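import Literature.Geometry.Lorentzian.DecaySymbols
import HarnessLib

/-!
# Smooth symbols at infinity: linear functions are symbols of order one

Support file (all results proved, no definitions, no named facts), a small addition to the
symbol calculus `IsBigOSmooth` of `DecaySymbols.lean` (Schoen–Yau 1979, (1.1)-style bookkeeping
`f = O_k(r^a)`): a continuous linear map `ℓ : E →L[ℝ] W` is a smooth symbol of order `1` to
second order — `‖ℓ y‖ ≤ ‖ℓ‖ ‖y‖`, `Dℓ ≡ ℓ` is bounded (`= O(r⁰)` on `r ≥ 1`) and `D²ℓ = 0`
(`isBigOSmooth_two_clm`). Consequences used for the chart components of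
axisymmetric metrics (the Boyer–Lindquist slice of Kerr in quasi-isotropic coordinates,
`h = (Σ/ρ²)δ + a²(1 + 2MR/Σ) ϖ ⊗ ϖ`, `ϖ = (x₁dx₂ − x₂dx₁)/ρ²`): coordinate functions of a
Euclidean space are order-`1` symbols (`isBigOSmooth_two_apply`), their pairwise products
order-`2` symbols (`isBigOSmooth_two_apply_mul_apply`), and `yᵢ yⱼ/‖y‖⁴` is an order-`(−2)` symbol
(`isBigOSmooth_two_apply_mul_apply_div_norm_pow_four`).

References: R. Schoen, S.-T. Yau, Comm. Math. Phys. 65 (1979), §1, (1.1); R. Bartnik, CPAM 39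
(1986), Def. 2.1 (weighted decay classes).
-/

noncomputable section

open Filter Asymptotics Bornology Set
open scoped Topology ContDiff

namespace Literature.Geometry.Lorentzian

variable {E : Type*} [NormedAddCommGroup E] [InnerProductSpace ℝ E]
  {W : Type*} [NormedAddCommGroup W] [NormedSpace ℝ W]

/-- **A continuous linear map is a smooth symbol of order `1`** (to second order):
`‖ℓ y‖ ≤ ‖ℓ‖‖y‖ = O(r)`, `‖Dℓ(y)‖ = ‖ℓ‖ = O(r⁰)` for `r ≥ 1`, `D²ℓ = 0`. [folklore] -/
theorem isBigOSmooth_two_clm (ℓ : E →L[ℝ] W) : IsBigOSmooth 2 1 (ℓ : E → W) := by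
  refine ⟨⟨0, ℓ.contDiff.contDiffOn⟩, fun m hm ↦ ?_⟩
  interval_cases m
  · -- `m = 0`
    have h : ∀ x : E, ‖iteratedFDeriv ℝ 0 (ℓ : E → W) x‖ ≤ ‖ℓ‖ * ‖x‖ := fun x ↦ by
      rw [norm_iteratedFDeriv_zero]; exact ℓ.le_opNorm x
    refine IsBigO.of_bound ‖ℓ‖ ?_
    filter_upwards with x
    rw [Real.norm_of_nonneg (norm_nonneg _), Nat.cast_zero, sub_zero, Real.rpow_one,
      Real.norm_of_nonneg (norm_nonneg _)]
    exact h x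
  · -- `m = 1`: `Dℓ = ℓ` constant
    refine IsBigO.of_bound ‖ℓ‖ ?_
    filter_upwards [eventually_cobounded_le_norm (E := E) 1] with x hx
    rw [Real.norm_of_nonneg (norm_nonneg _), norm_iteratedFDeriv_one, ℓ.fderiv, Nat.cast_one,
      sub_self, Real.rpow_zero, Real.norm_of_nonneg zero_le_one, mul_one]
  · -- `m = 2`: `D²ℓ = 0`
    have h0 : ∀ x : E, iteratedFDeriv ℝ 2 (ℓ : E → W) x = 0 := fun x ↦ by
      rw [iteratedFDeriv_succ_eq_comp_right]
      simp only [Function.comp_apply, ℓ.fderiv, iteratedFDeriv_const_of_ne (𝕜 := ℝ) one_ne_zero,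
        Pi.zero_apply]
      exact LinearIsometryEquiv.map_zero _
    refine IsBigO.of_bound 0 ?_
    filter_upwards with x
    simp [h0 x]

/-- **Coordinate functions of a Euclidean space are order-`1` symbols.** [folklore] -/
theorem isBigOSmooth_two_apply {n : ℕ} (i : Fin n) :
    IsBigOSmooth 2 1 fun y : EuclideanSpace ℝ (Fin n) ↦ y i :=
  isBigOSmooth_two_clm (EuclideanSpace.proj (𝕜 := ℝ) i)

/-- Products of two coordinate functions are order-`2` symbols. [folklore] -/
theorem isBigOSmooth_two_apply_mul_apply {n : ℕ} (i j : Fin n) :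
    IsBigOSmooth 2 2 fun y : EuclideanSpace ℝ (Fin n) ↦ y i * y j := by
  have h := (isBigOSmooth_two_apply i).mul (isBigOSmooth_two_apply j)
  norm_num at h
  exact h

/-- `‖y‖⁻⁴` is an order-`(−4)` symbol (to second order). [folklore] -/
theorem isBigOSmooth_inv_norm_pow_four :
    IsBigOSmooth 2 (-4) fun y : E ↦ (‖y‖ ^ 4)⁻¹ := by
  have h2 := (isBigOSmooth_inv_norm (E := E)).mul isBigOSmooth_inv_norm
  have h4 := h2.mul h2
  norm_num at h4
  refine h4.congr fun y ↦ ?_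
  ring

/-- **`yᵢ yⱼ/‖y‖⁴` is an order-`(−2)` symbol** — the coefficient functions of the axial term
`ϖ ⊗ ϖ`, `ϖ = (x₁ dx₂ − x₂ dx₁)/ρ²`, of an axisymmetric metric in Cartesian coordinates. [folklore] -/
theorem isBigOSmooth_two_apply_mul_apply_div_norm_pow_four {n : ℕ} (i j : Fin n) :
    IsBigOSmooth 2 (-2) fun y : EuclideanSpace ℝ (Fin n) ↦ y i * y j / ‖y‖ ^ 4 := by
  have h := (isBigOSmooth_two_apply_mul_apply i j).mul
    (isBigOSmooth_inv_norm_pow_four (E := EuclideanSpace ℝ (Fin n)))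
  norm_num at h
  refine h.congr fun y ↦ ?_
  rw [div_eq_mul_inv]

end Literature.Geometry.Lorentzian

end
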